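import Literature.AlgebraicGeometry.Motives.LinearSubspacesGenerateChowProofs
import Literature.AlgebraicGeometry.Motives.ProjectiveSpaceLinearSubspaces
import Literature.RingTheory.MvPolynomial.CubicFormLinearSubspaces
import Literature.RingTheory.MvPolynomial.FormsLinearSubspaces
import Literature.RingTheory.MvPolynomial.VanishingOnSubspace
import HarnessLib

/-!
# Planes and lines on cubic hypersurfaces as linear-subspace points

For a field `k`, a `k`-scheme `X` with a closed immersion `i : X ↪ ℙᴺ_k` whose image is the
hypersurface `V₊(F)` — the rendering of "`X ⊆ ℙᴺ` is the hypersurface `F = 0`" used by the named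
facts `TianZong2014_chowOne_generatedByLines` and `Mboro2018_chowTwo_cubic` — this file produces
linear-subspace points of `X` (`IsLinearSubspacePoint r N i z`, `Motives/LinearSubspacesGenerateChow`;
`IsLinePoint`, `Motives/LinesGenerateChowOne`):

* `exists_isLinearSubspacePoint_of_subset_ideal_span` (image `V₊(S)`, any set `S` of
  equations) and `exists_isLinearSubspacePoint_of_mem_ideal_span` (`S = {F}`) — **if
  `S ⊆ (L₁, …, L_{N-r})` for linearly independent linear forms `L_j` then `X` has an `r`-plane
  point**: the generic point of `V₊(L) ⊆ V₊(S) = i(X)` (`exists_point_of_linearIndependent`,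
  `closure_singleton_eq_zeroLocus` of `Motives/ProjectiveSpaceLinearSubspaces`) pulled back along
  the closed immersion (`height_base_eq_of_isClosedImmersion'`);
* `exists_isLinearSubspacePoint_two_of_cubic`, `exists_isLinearSubspacePoint_one_of_cubic`,
  `exists_isLinePoint_of_cubic` — over an ALGEBRAICALLY CLOSED field **every cubic hypersurface in
  `ℙᴺ` has a plane point if `N ≥ 8` and a line point if `N ≥ 4`** (greedy bounds; sharp:
  Debarre–Manivel 1998, Thm. 2.1), from the algebra of
  `Literature/RingTheory/MvPolynomial/CubicFormLinearSubspaces` (the cubic form vanishes on a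
  `3`- resp. `2`-dimensional subspace) and `…/VanishingOnSubspace` (hence lies in the ideal of the
  complementary linear forms); packaged for the routes' hypothesis `IsSmoothHypersurface n 3 X`
  as `IsSmoothHypersurface.exists_isLinearSubspacePoint_two` (`n ≥ 7`) and
  `IsSmoothHypersurface.exists_isLinePoint` (`n ≥ 3`);
* `exists_isLinePoint_of_forms`, `exists_isLinePoint_of_sum_degree_succ_le` — **every
  intersection of hypersurfaces of positive degrees `d_a` with `Σ d_a < N` contains a line**
  (`Literature/RingTheory/MvPolynomial/FormsLinearSubspaces`); in particular the setting of the
  named fact `TianZong2014_chowOne_generatedByLines` (`Σ d_a + 1 ≤ n + c`) is inhabited by lines;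
* `Mboro2018_chowTwo_cubic_of_inputs_and_projectiveSpace` — the skeleton of [Mboro2018] Cor. 2.9
  (`Mboro2018_chowTwo_cubic_of_primeCycle_inputs` of `Motives/LinearSubspacesGenerateChowProofs`)
  with its input (c) discharged down to projective space: what remains is (a) generation of
  irreducible surfaces by planes (`n ≥ 7`), (b) rational equivalence of any two planes (`n ≥ 9`),
  and (c') non-torsion of plane classes in `CH₂(ℙᴺ)` (Fulton §1.9) — none proved here.

## References

* [Mboro2018] R. Mboro, *Remarks on the `CH₂` of cubic hypersurfaces*, Geom. Dedicata 200
  (2018) = arXiv:1701.04488, Cor. 2.9 (p. 12).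
* [DebarreManivel1998] O. Debarre, L. Manivel, Math. Ann. 312 (1998), Thm. 2.1.
* [Hartshorne1977] R. Hartshorne, *Algebraic Geometry*, I Ex. 2.11 (linear varieties), II
  Prop. 2.5.
* [Fulton1998] W. Fulton, *Intersection Theory*, §1.9.
-/

noncomputable section

open CategoryTheory AlgebraicGeometry Order

universe u

namespace Literature.AlgebraicGeometry.Motives

variable {k : Type u} [Field k]

/-! ### From linear forms containing the equation to a linear-subspace point -/

section Producer

variable {N : ℕ} {X : SchemeOver k}

/-- **An `r`-plane `V₊(L₁, …, L_{N-r}) ⊆ V₊(S)` of the ambient space is an `r`-plane of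
`X = V₊(S)`.** For a closed `k`-immersion `i : X ↪ ℙᴺ_k` with image `V₊(S)` (`S` any set of
equations, e.g. a complete intersection) and `N - r` linearly independent linear forms `L_j`
with `S ⊆ (L₁, …, L_{N-r})`, the generic point `ℓ` of the linear subspace `V₊(L)`
(`exists_point_of_linearIndependent`: homogeneous prime `(L)`, dimension `N - (N - r) = r`)
lies on `V₊(S) = i(X)`, and its preimage `z` is an `r`-plane point of `X`
(`IsLinearSubspacePoint r N i z`): a closed immersion preserves dimensions of point closures
(`height_base_eq_of_isClosedImmersion'`) and `i(closure {z}) = closure {ℓ} = V₊(L)`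
(`closure_singleton_eq_zeroLocus`). [folklore] -/
theorem exists_isLinearSubspacePoint_of_subset_ideal_span {r : ℕ} (hr : r ≤ N)
    (S : Set (MvPolynomial (Fin (N + 1)) k)) (i : X ⟶ projectiveSpace N k)
    [IsClosedImmersion i.left]
    (hV : letI := MvPolynomial.gradedAlgebra (σ := Fin (N + 1)) (R := k)
      Set.range i.left.base =
        ProjectiveSpectrum.zeroLocus (MvPolynomial.homogeneousSubmodule (Fin (N + 1)) k) S)
    (L : Fin (N - r) → MvPolynomial (Fin (N + 1)) k) (hL : LinearIndependent k L)
    (hhom : ∀ j, (L j).IsHomogeneous 1) (hmem : S ⊆ Ideal.span (Set.range L)) :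
    ∃ z : ↥X.left, IsLinearSubspacePoint r N i z := by
  letI := MvPolynomial.gradedAlgebra (σ := Fin (N + 1)) (R := k)
  obtain ⟨ℓ, hℓ, hht, -⟩ := exists_point_of_linearIndependent L hL hhom (Nat.sub_le N r)
  have hset : ((ProjectiveSpectrum.asHomogeneousIdeal
      (𝒜 := MvPolynomial.homogeneousSubmodule (Fin (N + 1)) k) ℓ :
        HomogeneousIdeal (MvPolynomial.homogeneousSubmodule (Fin (N + 1)) k)) :
          Set (MvPolynomial (Fin (N + 1)) k)) =
      (Ideal.span (Set.range L) : Set (MvPolynomial (Fin (N + 1)) k)) := by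
    rw [← hℓ]
    rfl
  -- `ℓ` lies on `V₊(S) = i(X)`
  have hℓS : ℓ ∈ Set.range i.left.base := by
    set P : ProjectiveSpectrum (MvPolynomial.homogeneousSubmodule (Fin (N + 1)) k) := ℓ with hP
    have key : P ∈ ProjectiveSpectrum.zeroLocus
        (MvPolynomial.homogeneousSubmodule (Fin (N + 1)) k) S := by
      rw [ProjectiveSpectrum.mem_zeroLocus, hP, hset]
      exact hmem
    rw [hV]
    exact key
  obtain ⟨z, hz⟩ := hℓS
  refine ⟨z, ?_, L, hL, hhom, ?_⟩
  · rw [← height_base_eq_of_isClosedImmersion' i.left z, hz, hht]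
    congr 1
    omega
  · rw [← i.left.isClosedEmbedding.closure_image_eq, Set.image_singleton, hz,
      closure_singleton_eq_zeroLocus, hset, ProjectiveSpectrum.zeroLocus_span]

/-- The hypersurface case `S = {F}`: if `F ∈ (L₁, …, L_{N-r})` for linearly independent linear
forms `L_j` then `X = V₊(F)` has an `r`-plane point. [folklore] -/
theorem exists_isLinearSubspacePoint_of_mem_ideal_span {r : ℕ} (hr : r ≤ N)
    (F : MvPolynomial (Fin (N + 1)) k) (i : X ⟶ projectiveSpace N k) [IsClosedImmersion i.left]
    (hV : letI := MvPolynomial.gradedAlgebra (σ := Fin (N + 1)) (R := k)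
      Set.range i.left.base =
        ProjectiveSpectrum.zeroLocus (MvPolynomial.homogeneousSubmodule (Fin (N + 1)) k) {F})
    (L : Fin (N - r) → MvPolynomial (Fin (N + 1)) k) (hL : LinearIndependent k L)
    (hhom : ∀ j, (L j).IsHomogeneous 1) (hmem : F ∈ Ideal.span (Set.range L)) :
    ∃ z : ↥X.left, IsLinearSubspacePoint r N i z :=
  exists_isLinearSubspacePoint_of_subset_ideal_span hr {F} i hV L hL hhom
    (Set.singleton_subset_iff.mpr hmem)

end Producer

/-! ### Lines and planes on cubic hypersurfaces -/

section Cubics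

variable {N : ℕ} {X : SchemeOver k}

/-- Pointwise vanishing on all `Σ_j c_j w_j` is vanishing on `span(w)`. [folklore] -/
theorem forall_mem_span_eval_eq_zero {u : ℕ} {F : MvPolynomial (Fin (N + 1)) k}
    {w : Fin u → Fin (N + 1) → k}
    (hv : ∀ c : Fin u → k, MvPolynomial.eval (fun m => ∑ j, c j * w j m) F = 0) :
    ∀ v ∈ Submodule.span k (Set.range w), MvPolynomial.eval v F = 0 := by
  intro v hv'
  rw [← Fintype.range_linearCombination] at hv'
  obtain ⟨c, rfl⟩ := hv'
  have h : (Fintype.linearCombination k w c : Fin (N + 1) → k) = fun m => ∑ j, c j * w j m := by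
    ext m
    simp [Fintype.linearCombination_apply, Finset.sum_apply]
  rw [h]
  exact hv c

/-- **Every cubic hypersurface `X ⊆ ℙᴺ_k` with `N ≥ 8` over an algebraically closed field has a
plane point** (`IsLinearSubspacePoint 2 N i z`: an irreducible surface `closure {z} ⊆ X` mapped
by `i` onto a `2`-plane `V₊(L₁, …, L_{N-2})` of `ℙᴺ`). Here `X` is any `k`-scheme with a closed
immersion `i : X ↪ ℙᴺ_k` whose image is `V₊(F)` for a cubic form `F` (e.g. a smooth cubic
`(N-1)`-fold, `N - 1 ≥ 7`). The cubic form vanishes on a `3`-dimensional subspace of `kᴺ⁺¹`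
(`Literature.RingTheory.MvPolynomial.exists_linearIndependent_three_eval_cubic_eq_zero`, the
greedy dimension count), hence lies in the ideal of `N - 2` independent linear forms
(`…exists_linearForms_mem_ideal_span_of_forall_eval_eq_zero`), and
`exists_isLinearSubspacePoint_of_mem_ideal_span` applies. (Sharp range `N ≥ 6`:
Debarre–Manivel, Math. Ann. 312 (1998), Thm. 2.1.) [folklore] -/
theorem exists_isLinearSubspacePoint_two_of_cubic [IsAlgClosed k] (hN : 8 ≤ N)
    (F : MvPolynomial (Fin (N + 1)) k) (hF : F.IsHomogeneous 3)
    (i : X ⟶ projectiveSpace N k) [IsClosedImmersion i.left]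
    (hV : letI := MvPolynomial.gradedAlgebra (σ := Fin (N + 1)) (R := k)
      Set.range i.left.base =
        ProjectiveSpectrum.zeroLocus (MvPolynomial.homogeneousSubmodule (Fin (N + 1)) k) {F}) :
    ∃ z : ↥X.left, IsLinearSubspacePoint 2 N i z := by
  obtain ⟨w, hw, hv⟩ :=
    Literature.RingTheory.MvPolynomial.exists_linearIndependent_three_eval_cubic_eq_zero hN hF
  obtain ⟨t, L, ht, hL, hhom, hmem⟩ :=
    Literature.RingTheory.MvPolynomial.exists_linearForms_mem_ideal_span_of_forall_eval_eq_zero hw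
      (forall_mem_span_eval_eq_zero hv)
  obtain rfl : t = N - 2 := by omega
  exact exists_isLinearSubspacePoint_of_mem_ideal_span (by omega) F i hV L hL hhom hmem

/-- **Every cubic hypersurface `X ⊆ ℙᴺ_k` with `N ≥ 4` over an algebraically closed field has a
line point** in the sense of `IsLinearSubspacePoint 1` (a cubic form in `≥ 5` variables vanishes
on a `2`-dimensional subspace). [folklore] -/
theorem exists_isLinearSubspacePoint_one_of_cubic [IsAlgClosed k] (hN : 4 ≤ N)
    (F : MvPolynomial (Fin (N + 1)) k) (hF : F.IsHomogeneous 3)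
    (i : X ⟶ projectiveSpace N k) [IsClosedImmersion i.left]
    (hV : letI := MvPolynomial.gradedAlgebra (σ := Fin (N + 1)) (R := k)
      Set.range i.left.base =
        ProjectiveSpectrum.zeroLocus (MvPolynomial.homogeneousSubmodule (Fin (N + 1)) k) {F}) :
    ∃ z : ↥X.left, IsLinearSubspacePoint 1 N i z := by
  obtain ⟨w, hw, hv⟩ :=
    Literature.RingTheory.MvPolynomial.exists_linearIndependent_two_eval_cubic_eq_zero hN hF
  obtain ⟨t, L, ht, hL, hhom, hmem⟩ :=
    Literature.RingTheory.MvPolynomial.exists_linearForms_mem_ideal_span_of_forall_eval_eq_zero hw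
      (forall_mem_span_eval_eq_zero hv)
  obtain rfl : t = N - 1 := by omega
  exact exists_isLinearSubspacePoint_of_mem_ideal_span (by omega) F i hV L hL hhom hmem

/-- **Every cubic hypersurface `X ⊆ ℙᴺ_k` with `N ≥ 4` over an algebraically closed field
contains a line** (`IsLinePoint`, the vocabulary of `Motives/LinesGenerateChowOne`). [folklore] -/
theorem exists_isLinePoint_of_cubic [IsAlgClosed k] (hN : 4 ≤ N)
    (F : MvPolynomial (Fin (N + 1)) k) (hF : F.IsHomogeneous 3)
    (i : X ⟶ projectiveSpace N k) [IsClosedImmersion i.left]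
    (hV : letI := MvPolynomial.gradedAlgebra (σ := Fin (N + 1)) (R := k)
      Set.range i.left.base =
        ProjectiveSpectrum.zeroLocus (MvPolynomial.homogeneousSubmodule (Fin (N + 1)) k) {F}) :
    ∃ z : ↥X.left, IsLinePoint N i z := by
  obtain ⟨z, hz⟩ := exists_isLinearSubspacePoint_one_of_cubic hN F hF i hV
  exact ⟨z, (isLinePoint_iff_isLinearSubspacePoint_one z).mpr hz⟩

/-- **A smooth cubic hypersurface of dimension `n ≥ 7` over an algebraically closed field
contains a plane**, in the vocabulary of the routes (`IsSmoothHypersurface n 3 X`,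
`Motives/Sweep1`): for the closed immersion `i : X ↪ ℙⁿ⁺¹_k` witnessing the hypersurface
structure there is a plane point `z` (`IsLinearSubspacePoint 2 (n + 1) i z`). [folklore] -/
theorem IsSmoothHypersurface.exists_isLinearSubspacePoint_two [IsAlgClosed k] {n : ℕ}
    (hX : IsSmoothHypersurface n 3 X) (hn : 7 ≤ n) :
    ∃ i : X ⟶ projectiveSpace (n + 1) k, IsClosedImmersion i.left ∧
      ∃ z : ↥X.left, IsLinearSubspacePoint 2 (n + 1) i z := by
  obtain ⟨-, F, hF, -, -, i, hi, hV⟩ := hX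
  haveI := hi
  exact ⟨i, hi, exists_isLinearSubspacePoint_two_of_cubic (by omega) F hF i hV⟩

/-- **A smooth cubic hypersurface of dimension `n ≥ 3` over an algebraically closed field
contains a line** (`IsLinePoint`). [folklore] -/
theorem IsSmoothHypersurface.exists_isLinePoint [IsAlgClosed k] {n : ℕ}
    (hX : IsSmoothHypersurface n 3 X) (hn : 3 ≤ n) :
    ∃ i : X ⟶ projectiveSpace (n + 1) k, IsClosedImmersion i.left ∧
      ∃ z : ↥X.left, IsLinePoint (n + 1) i z := by
  obtain ⟨-, F, hF, -, -, i, hi, hV⟩ := hX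
  haveI := hi
  exact ⟨i, hi, exists_isLinePoint_of_cubic (by omega) F hF i hV⟩

end Cubics

/-! ### Mboro's Cor. 2.9 from (a), (b) and the non-torsion of planes of projective space -/

section Skeleton

/-- **[Mboro2018] Cor. 2.9 from two cycle-level inputs on `X` and one on projective space.**
Refines `Mboro2018_chowTwo_cubic_of_primeCycle_inputs`: its input (c) (a non-torsion plane on
every smooth cubic `n`-fold, `n ≥ 9`) follows from the existence of planes on cubics in `ℙⁿ⁺¹`,
`n + 1 ≥ 8` (`exists_isLinearSubspacePoint_two_of_cubic`) and the non-torsion of planes modulo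
rational equivalence on PROJECTIVE SPACE
(`IsLinearSubspacePoint.nsmul_primeCycle_notMem_ratTrivial_of_forall_projectiveSpace`). The
remaining inputs: (a) (`n ≥ 7`) every irreducible surface of `X` is rationally equivalent to an
integral combination of planes (Prop. 1.4 + Thm. 2.8 in print); (b) (`n ≥ 9`) any two planes of
`X` are rationally equivalent (Debarre–Manivel); (c') for every `N` and every `2`-plane point `w`
of `ℙᴺ_k`, no positive multiple of `[closure {w}]` lies in `Rat₂(ℙᴺ)` (Fulton §1.9: the class of a
plane generates `CH₂(ℙᴺ) ≅ ℤ`). None of (a), (b), (c') is proved here.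
[cite: Mboro2018, Cor. 2.9 and its proof (arXiv:1701.04488 p. 12)] -/
theorem Mboro2018_chowTwo_cubic_of_inputs_and_projectiveSpace
    (ha : ∀ ⦃k : Type u⦄ [Field k] [IsAlgClosed k] [CharZero k] (n : ℕ) ⦃X : SchemeOver k⦄
      (F : MvPolynomial (Fin (n + 1 + 1)) k) (i : X ⟶ projectiveSpace (n + 1) k),
      letI := MvPolynomial.gradedAlgebra (σ := Fin (n + 1 + 1)) (R := k)
      IsSmoothProjective n X → F.IsHomogeneous 3 → Irreducible F → IsClosedImmersion i.left →
        Set.range i.left.base =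
          ProjectiveSpectrum.zeroLocus (MvPolynomial.homogeneousSubmodule (Fin (n + 1 + 1)) k)
            {F} →
          7 ≤ n → ∀ z : ↥X.left, Order.height z = 2 →
            ∃ (s : Finset ↥X.left) (w : ↥X.left → ℤ),
              (∀ y ∈ s, IsLinearSubspacePoint 2 (n + 1) i y) ∧
                IsRationallyEquivalent (primeCycle z) (∑ y ∈ s, w y • primeCycle y) 2)
    (hb : ∀ ⦃k : Type u⦄ [Field k] [IsAlgClosed k] [CharZero k] (n : ℕ) ⦃X : SchemeOver k⦄
      (F : MvPolynomial (Fin (n + 1 + 1)) k) (i : X ⟶ projectiveSpace (n + 1) k),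
      letI := MvPolynomial.gradedAlgebra (σ := Fin (n + 1 + 1)) (R := k)
      IsSmoothProjective n X → F.IsHomogeneous 3 → Irreducible F → IsClosedImmersion i.left →
        Set.range i.left.base =
          ProjectiveSpectrum.zeroLocus (MvPolynomial.homogeneousSubmodule (Fin (n + 1 + 1)) k)
            {F} →
          9 ≤ n → ∀ ⦃z z' : ↥X.left⦄, IsLinearSubspacePoint 2 (n + 1) i z →
            IsLinearSubspacePoint 2 (n + 1) i z' →
              IsRationallyEquivalent (primeCycle z) (primeCycle z') 2)
    (hP : ∀ ⦃k : Type u⦄ [Field k] [IsAlgClosed k] [CharZero k] (N : ℕ)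
      (w : ↥(projectiveSpace N k).left),
      IsLinearSubspacePoint 2 N (𝟙 (projectiveSpace N k)) w →
        ∀ m : ℕ, 0 < m → m • primeCycle w ∉ ratTrivial (projectiveSpace N k).left 2) :
    Mboro2018_chowTwo_cubic.{u} := by
  refine Mboro2018_chowTwo_cubic_of_primeCycle_inputs ha hb ?_
  intro k _ _ _ n X F i hX hF hirr hi hV hn
  haveI := hi
  obtain ⟨z₀, hz₀⟩ := exists_isLinearSubspacePoint_two_of_cubic (N := n + 1) (by omega) F hF i hV
  exact ⟨z₀, hz₀, fun m hm =>
    hz₀.nsmul_primeCycle_notMem_ratTrivial_of_forall_projectiveSpace (hP (n + 1)) hm⟩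

end Skeleton

/-! ### Lines on intersections of hypersurfaces of small degree -/

section Systems

variable {N : ℕ} {X : SchemeOver k}

/-- **Every intersection of hypersurfaces `X = V₊(F_a : a ∈ ι) ⊆ ℙᴺ_k` of positive degrees
`d_a` with `Σ_a d_a < N`, over an algebraically closed field, contains a line** (`IsLinePoint`):
the forms vanish on a common `2`-dimensional subspace of `kᴺ⁺¹`
(`Literature.RingTheory.MvPolynomial.exists_linearIndependent_two_forall_eval_eq_zero`, greedy
count `Σ d_a + 1 < N + 1`), hence all lie in the ideal of one system of `N - 1` independent
linear forms (`…exists_linearForms_forall_mem_ideal_span`), and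
`exists_isLinearSubspacePoint_of_subset_ideal_span` applies. Here `X` is any `k`-scheme with a
closed immersion `i` onto `V₊(F)` (e.g. the complete intersections of
`Motives/CompleteIntersection`). [folklore] -/
theorem exists_isLinePoint_of_forms [IsAlgClosed k] {ι : Type*} [Fintype ι]
    (F : ι → MvPolynomial (Fin (N + 1)) k) (d : ι → ℕ) (hF : ∀ a, (F a).IsHomogeneous (d a))
    (hd : ∀ a, 0 < d a) (hN : ∑ a, d a < N) (i : X ⟶ projectiveSpace N k)
    [IsClosedImmersion i.left]
    (hV : letI := MvPolynomial.gradedAlgebra (σ := Fin (N + 1)) (R := k)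
      Set.range i.left.base =
        ProjectiveSpectrum.zeroLocus (MvPolynomial.homogeneousSubmodule (Fin (N + 1)) k)
          (Set.range F)) :
    ∃ z : ↥X.left, IsLinePoint N i z := by
  obtain ⟨w, hw, hv⟩ :=
    Literature.RingTheory.MvPolynomial.exists_linearIndependent_two_forall_eval_eq_zero hF hd hN
  obtain ⟨t, L, ht, hL, hhom, hmem⟩ :=
    Literature.RingTheory.MvPolynomial.exists_linearForms_forall_mem_ideal_span (k := k) hw
  obtain rfl : t = N - 1 := by omega
  obtain ⟨z, hz⟩ := exists_isLinearSubspacePoint_of_subset_ideal_span (r := 1) (by omega)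
    (Set.range F) i hV L hL hhom (by
      rintro _ ⟨a, rfl⟩
      exact hmem (F a) (forall_mem_span_eval_eq_zero fun c => hv a c))
  exact ⟨z, (isLinePoint_iff_isLinearSubspacePoint_one z).mpr hz⟩

/-- **Non-vacuity of the Tian–Zong setting.** Under the shape of the hypotheses of the named fact
`TianZong2014_chowOne_generatedByLines` — forms `F_a` of degrees `d_a ≥ 1` on `ℙⁿ⁺ᶜ`, a closed
immersion `i : X ↪ ℙⁿ⁺ᶜ` onto `V₊(F)`, and the degree bound `Σ d_a + 1 ≤ n + c` — `X` contains a
line (`IsLinePoint (n + c) i z`), over any algebraically closed field (no smoothness, Jacobian or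
characteristic hypothesis is needed for this). E.g. the `(2,3)` complete intersections in `ℙ⁸`.
[folklore] -/
theorem exists_isLinePoint_of_sum_degree_succ_le [IsAlgClosed k] {c : ℕ} (n : ℕ) (d : Fin c → ℕ)
    (F : Fin c → MvPolynomial (Fin (n + c + 1)) k) (i : X ⟶ projectiveSpace (n + c) k)
    (hF : ∀ a, (F a).IsHomogeneous (d a)) (hd : ∀ a, 0 < d a) [IsClosedImmersion i.left]
    (hV : letI := MvPolynomial.gradedAlgebra (σ := Fin (n + c + 1)) (R := k)
      Set.range i.left.base =
        ProjectiveSpectrum.zeroLocus (MvPolynomial.homogeneousSubmodule (Fin (n + c + 1)) k)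
          (Set.range F))
    (hdeg : (∑ a, d a) + 1 ≤ n + c) : ∃ z : ↥X.left, IsLinePoint (n + c) i z :=
  exists_isLinePoint_of_forms F d hF hd (by omega) i hV

end Systems

end Literature.AlgebraicGeometry.Motives

end
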